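import Literature.AnabelianGeometry.AbsoluteAnabelian.GaloisCyclotome
import HarnessLib

/-!
# The Verlagerung between open subgroups in orbit (double coset) form

Topic `AnabelianGeometry/AbsoluteAnabelian`; namespace
`Literature.AnabelianGeometry.AbsoluteAnabelian`.  Proof-only.  For a compact group `G` and open
subgroups `V ≤ U`, the Verlagerung `U^ab → V^ab` of `GaloisCyclotome.lean` ([AbsTopIII] Cor. 1.10 (i),
"the Verlagerung, or transfer, map") evaluated by Mathlib's orbit formula for the transfer
(`MonoidHom.transfer_eq_prod_quotient_orbitRel_zpowers_quot`, Serre VII §8 Prop. 8):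

* `verlagerung_mk_eq_prod_orbits` — `Ver([u]) = ∏_q [g_q⁻¹ u^{f_q} g_q]`, the product over the orbits
  `q` of `⟨u⟩` on `U/V`, `g_q = q.out.out`, `f_q` the orbit length.

This is the shape in which Neukirch's Prop. IV (5.9) (`AbstractCFT.WeilDatum.IsClassFieldTheory.
recMap_transfer`, `Literature/NumberTheory/GaloisRepresentations/AbstractReciprocityTransfer.lean`)
computes the reciprocity map of a transfer; the two are compared in the sequel (local transfer
theorem, input of `MLFGaloisCyclotomeIsRootsOfUnity`).  HONEST FRAMING: group theory only; nothing
here bears on [IUTchIII] Cor. 3.12.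
-/

noncomputable section

namespace Literature.AnabelianGeometry.AbsoluteAnabelian

universe u

variable {G : Type u} [Group G] [TopologicalSpace G] [IsTopologicalGroup G] [CompactSpace G]
  {U V : Subgroup G}

omit [CompactSpace G] in
/-- `toAbelianizationOfLe h x = [x]` (the element `x ∈ V ∩ U` read in `V`, then in `V^ab`).
[cite: MochizukiAbsTopIII2015, Cor 1.10 (i) p.42] -/
theorem toAbelianizationOfLe_apply (h : V ≤ U) (x : V.subgroupOf U) :
    toAbelianizationOfLe h x = QuotientGroup.mk (⟨((x : U) : G), x.2⟩ : V) :=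
  rfl

/-- **The Verlagerung in orbit form**: for open `V ≤ U` in a compact group and `u ∈ U`,
`Ver([u]) = ∏_q [q.out.out⁻¹ · u^{f_q} · q.out.out]` in `V^ab`, the product over the orbits `q` of
`⟨u⟩` acting on `U/V`, `f_q` the orbit length ("`Ver(s) = ∏ x_i · s^{f_i} · x_i⁻¹ mod H'`",
Serre VII §8 Prop. 8, with `x_i = q.out.out⁻¹`). [cite: MochizukiAbsTopIII2015, Cor 1.10 (i) p.42] -/
theorem verlagerung_mk_eq_prod_orbits (hU : IsOpen (U : Set G)) (hV : IsOpen (V : Set G))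
    (h : V ≤ U) (u : U)
    [Fintype (MulAction.orbitRel.Quotient (Subgroup.zpowers u) (U ⧸ V.subgroupOf U))] :
    verlagerung hU hV h (QuotientGroup.mk u) =
      ∏ q : MulAction.orbitRel.Quotient (Subgroup.zpowers u) (U ⧸ V.subgroupOf U),
        (QuotientGroup.mk (⟨((q.out.out⁻¹ * u ^ Function.minimalPeriod (u • ·) q.out * q.out.out : U) : G),
          QuotientGroup.out_conj_pow_minimalPeriod_mem (V.subgroupOf U) u q.out⟩ : V) :
          TopologicalAbelianization V) := by
  haveI := finiteIndex_subgroupOf hU hV (V := V)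
  rw [verlagerung_mk]
  unfold transferToAbelianization
  rw [MonoidHom.transfer_eq_prod_quotient_orbitRel_zpowers_quot]
  rfl

end Literature.AnabelianGeometry.AbsoluteAnabelian
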